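import Literature.Analysis.OperatorTheory.Enflo2023.Basic
import Literature.Analysis.OperatorTheory.Enflo2023.Reductions
import Literature.Analysis.OperatorTheory.Enflo2023.NormalCase
import HarnessLib

/-!
# Enflo 2023, repair census: operators COMMUTING WITH A NON-ZERO COMPACT OPERATOR (row R8, second clause) —
# Lomonosov's hyperinvariant-subspace theorem closed in Lean, outside the mechanism

Source under adjudication: Per H. Enflo, *On the invariant subspace problem in Hilbert spaces*, arXiv:2305.15442 (v1
2023, v2 2024), bib key `Enflo2023` — a CLAIMED proof of the invariant subspace problem for operators on a separable
Hilbert space.  This file is part of the kernel-tight typing of the manuscript by the b2b-enflo repair cell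
(formaliser 2, Part B: (28)–(47), the limiting argument and the final deduction).  It records what FOLLOWS (proved
implications from the manuscript's displayed hypotheses) and, where a step does not follow, the typed inference
together with its refutation.  NOTHING here asserts that the manuscript's main theorem holds; no declaration concludes
the invariant subspace problem for an arbitrary operator.  Value (BLOCK-2b): theorems / refutations of typed
inferences about a text — not progress on the problem.

REPAIR-CENSUS row R8, THEOREM column.  The census (REPAIR-CENSUS.md, formaliser 2) closed the first clause ("`T`
compact", `CompactCase.lean`, and "`p(T)` compact", `PolyCompactCase.lean`) in Lean but left the second clause — "`T`
commutes with a non-zero compact operator" (Lomonosov 1973) — as a CITED theorem, on the grounds that Lomonosov's proof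
goes through the Schauder fixed-point theorem.  That is not needed: Hilden's proof of the hyperinvariant form
(Radjavi–Rosenthal, *Invariant Subspaces* (1973), Corollary 8.25 "every non-zero compact operator has a non-trivial
hyperinvariant subspace"; the fixed-point-free argument is recorded in Michaels, *Hilden's simple proof of Lomonosov's
invariant subspace theorem*, Adv. Math. 25 (1977) 56–58) uses only the Fredholm alternative (`σ(K) ∖ {0}` consists of
eigenvalues: Mathlib `IsCompactOperator.hasEigenvalue_iff_mem_spectrum`), compactness of `closure (K '' B)` for a
closed ball `B`, and Gelfand's formula for a quasinilpotent `K` (Mathlib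
`spectrum.pow_norm_pow_one_div_tendsto_nhds_spectralRadius`).  This file carries it out:

* `commutantOrbit K y` — the linear subspace `{S y : S K = K S}`; its closure is invariant under every operator
  commuting with `K` (`isInvariant_commutantOrbit_topologicalClosure`), so if `K` has NO non-trivial closed
  hyperinvariant subspace then every non-zero vector has a DENSE commutant orbit
  (`dense_commutantOrbit_of_no_hyperinvariant`);
* `tendsto_pow_mul_norm_pow_of_spectrum_subset_zero` — `σ(K) ⊆ {0}` gives `c ^ n * ‖K ^ n‖ → 0` for every `c ≥ 0`;
* `exists_hyperinvariant_of_isCompactOperator_of_spectrum_subset_zero` — HILDEN'S ARGUMENT for a non-zero compact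
  quasinilpotent `K`: a closed ball `B` around `x₀` with `0 ∉ closure (K '' B)`, a finite subcover of the compact set
  `closure (K '' B)` by preimages `A⁻¹(int B)` over the commutant (density), the constant `c = Σ ‖Aᵢ‖`, and the iteration
  `x_{m+1} = A_{i_m} K x_m ∈ B`, `x_m = P_m K^m x₀` with `‖P_m‖ ≤ c^m`, contradict `‖x_m‖ ≥ ‖x₀‖ − 1 > 0`;
* `exists_hyperinvariant_of_hasEigenvalue` — the other branch: an eigenvalue `μ` of a non-scalar `K` gives the
  hyperinvariant subspace `ker (K − μ)`; a compact `K` on an infinite-dimensional space is never a non-zero scalar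
  (`ne_smul_one_of_isCompactOperator`, Mathlib `FiniteDimensional.of_isCompactOperator_id`);
* `exists_hyperinvariant_of_isCompactOperator` = Radjavi–Rosenthal Cor. 8.25 / Lomonosov: every non-zero compact
  operator on an infinite-dimensional complex Hilbert space has a non-trivial closed hyperinvariant subspace
  [cite: RadjaviRosenthal1973, Cor. 8.25] [cite: Lomonosov1973] [cite: Michaels1977];
* consequences in the census vocabulary (`HasNontrivialClosedInvariantSubspace`, `Basic.lean`):
  `hasNontrivialClosedInvariantSubspace_of_commute_isCompactOperator` (any `T` commuting with a non-zero compact `K`,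
  `dim H ≥ 2` as `1 < Module.rank ℂ H`; finite dimension is an eigenline, `Reductions.lean`),
  `hasNontrivialClosedInvariantSubspace_of_isCompactOperator` (compact `T` itself, unconditionally in `dim H ≥ 2` —
  `CompactCase.lean` proved this row only from Main-Construction data), and `…_of_commute_isCompactOperator_MC` (the row
  in the shape of R8/R9/R12: the p.4 Main-Construction output data are used ONLY to exclude `dim H ≤ 1`).

Reading for the census.  As for R8 (compact), R9 (normal) and R12 (polynomially compact), it is NOT the manuscript's
mechanism (norm convergence of the MC outputs, the room claim of v2 p.20 — refuted with every standing hypothesis in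
`RoomClaimT.lean`, row R13) that proves the theorem in this class: Hilden's compactness argument does, and no Main
Construction data is needed at all.  What stays open as a THEOREM is row R10 (essentially normal `T = N + K`) and the
general operator.  The results here are classical (1973/1977) and not claimed new.
Origin: planner-b2b-enflo-2-g4-0 (formaliser 2, gen-4), 2026-08-18.  Mathlib only (Fredholm alternative for compact
operators, Riesz' compactness-of-the-identity lemma, Gelfand's formula).
-/

open scoped InnerProductSpace NNReal ENNReal
open Filter Topology

namespace Literature.Analysis.OperatorTheory.Enflo2023

variable {H : Type*} [NormedAddCommGroup H] [InnerProductSpace ℂ H]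

/-! ### The orbit of a vector under the commutant of `K` -/

/-- The orbit `{S y : S commutes with K}` of the vector `y` under the commutant of `K`.  It is a linear subspace
(the commutant is a subalgebra); its closure is the smallest closed subspace containing `y` that is invariant under
every operator commuting with `K`. [folklore] -/
def commutantOrbit (K : H →L[ℂ] H) (y : H) : Submodule ℂ H where
  carrier := {x | ∃ S : H →L[ℂ] H, Commute S K ∧ S y = x}
  add_mem' := by
    rintro _ _ ⟨S₁, h₁, rfl⟩ ⟨S₂, h₂, rfl⟩
    exact ⟨S₁ + S₂, h₁.add_left h₂, rfl⟩
  zero_mem' := ⟨0, Commute.zero_left K, rfl⟩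
  smul_mem' := by
    rintro c _ ⟨S, h, rfl⟩
    exact ⟨c • S, h.smul_left c, rfl⟩

/-- Membership in the commutant orbit, by definition. [folklore] -/
lemma mem_commutantOrbit {K : H →L[ℂ] H} {y x : H} :
    x ∈ commutantOrbit K y ↔ ∃ S : H →L[ℂ] H, Commute S K ∧ S y = x := Iff.rfl

/-- `y` lies in its own commutant orbit (`S = 1`). [folklore] -/
lemma self_mem_commutantOrbit (K : H →L[ℂ] H) (y : H) : y ∈ commutantOrbit K y :=
  ⟨1, Commute.one_left K, rfl⟩

/-- The commutant orbit is mapped into itself by every operator commuting with `K`. [folklore] -/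
lemma apply_mem_commutantOrbit {K S : H →L[ℂ] H} (hS : Commute S K) {y x : H} (hx : x ∈ commutantOrbit K y) :
    S x ∈ commutantOrbit K y := by
  obtain ⟨S', hS', rfl⟩ := hx
  exact ⟨S * S', hS.mul_left hS', rfl⟩

/-- The CLOSURE of the commutant orbit of `y` is invariant under every operator commuting with `K`. [folklore] -/
lemma isInvariant_commutantOrbit_topologicalClosure {K S : H →L[ℂ] H} (hS : Commute S K) (y : H) :
    IsInvariant S (commutantOrbit K y).topologicalClosure := by
  intro x hx
  have hmaps : Set.MapsTo S (commutantOrbit K y : Set H) (commutantOrbit K y : Set H) :=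
    fun z hz => apply_mem_commutantOrbit hS hz
  have h := hmaps.closure S.continuous
  rw [← Submodule.topologicalClosure_coe] at h
  exact h hx

/-- If `K` has NO non-trivial closed hyperinvariant subspace, then the commutant orbit of every non-zero vector is
dense (its closure is closed, hyperinvariant and contains `y ≠ 0`, hence is all of `H`). [folklore] -/
lemma dense_commutantOrbit_of_no_hyperinvariant {K : H →L[ℂ] H}
    (hno : ∀ M : Submodule ℂ H, IsClosed (M : Set H) → M ≠ ⊥ → M ≠ ⊤ →
      ∃ S : H →L[ℂ] H, Commute S K ∧ ¬ IsInvariant S M) {y : H} (hy : y ≠ 0) :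
    Dense (commutantOrbit K y : Set H) := by
  rw [Submodule.dense_iff_topologicalClosure_eq_top]
  by_contra htop
  have hbot : (commutantOrbit K y).topologicalClosure ≠ ⊥ := by
    intro hbot
    have hy' : y ∈ (commutantOrbit K y).topologicalClosure :=
      Submodule.le_topologicalClosure _ (self_mem_commutantOrbit K y)
    rw [hbot, Submodule.mem_bot] at hy'
    exact hy hy'
  obtain ⟨S, hS, hSM⟩ := hno _ (Submodule.isClosed_topologicalClosure _) hbot htop
  exact hSM (isInvariant_commutantOrbit_topologicalClosure hS y)

/-! ### Quasinilpotent operators: `c ^ n * ‖K ^ n‖ → 0` -/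

/-- Gelfand's formula for an operator with `σ(K) ⊆ {0}`: `‖K ^ n‖ ^ (1/n) → 0`, hence `c ^ n * ‖K ^ n‖ → 0` for
every constant `c ≥ 0` (eventually `‖K ^ n‖ ≤ ε ^ n` with `c ε ≤ 1/2`). [folklore] -/
theorem tendsto_pow_mul_norm_pow_of_spectrum_subset_zero [CompleteSpace H] (K : H →L[ℂ] H)
    (hσ : spectrum ℂ K ⊆ {0}) {c : ℝ} (hc : 0 ≤ c) :
    Tendsto (fun n : ℕ => c ^ n * ‖K ^ n‖) atTop (𝓝 0) := by
  have hr : spectralRadius ℂ K = 0 := by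
    refine le_antisymm (iSup₂_le fun k hk => ?_) zero_le
    rw [Set.mem_singleton_iff.mp (hσ hk), nnnorm_zero, ENNReal.coe_zero]
  have hG := spectrum.pow_norm_pow_one_div_tendsto_nhds_spectralRadius K
  rw [hr] at hG
  -- the real form of Gelfand's formula: `‖K ^ n‖ ^ (1/n) → 0`
  have hreal : Tendsto (fun n : ℕ => ‖K ^ n‖ ^ (1 / (n : ℝ))) atTop (𝓝 0) := by
    have h1 := (ENNReal.tendsto_toReal ENNReal.zero_ne_top).comp hG
    have h2 : (fun n : ℕ => ‖K ^ n‖ ^ (1 / (n : ℝ))) =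
        ENNReal.toReal ∘ (fun n : ℕ => ENNReal.ofReal (‖K ^ n‖ ^ (1 / (n : ℝ)))) := by
      funext n
      simp [ENNReal.toReal_ofReal (Real.rpow_nonneg (norm_nonneg _) _)]
    rw [h2]
    simpa using h1
  -- a rate `ε` with `c * ε ≤ 1/2`
  set ε : ℝ := 1 / (2 * (c + 1)) with hε
  have hε0 : 0 < ε := by positivity
  have hcε : c * ε ≤ 1 / 2 := by
    have hc1 : (0 : ℝ) < 2 * (c + 1) := by positivity
    rw [hε, mul_one_div, div_le_iff₀ hc1]
    linarith
  have hev : ∀ᶠ n : ℕ in atTop, c ^ n * ‖K ^ n‖ ≤ (1 / 2 : ℝ) ^ n := by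
    have h1 := (tendsto_order.1 hreal).2 ε hε0
    filter_upwards [h1, eventually_ge_atTop 1] with n hn hn1
    have hx : 0 ≤ ‖K ^ n‖ := norm_nonneg _
    have hKn : ‖K ^ n‖ ≤ ε ^ n := by
      have hpow : (‖K ^ n‖ ^ (1 / (n : ℝ))) ^ n = ‖K ^ n‖ := by
        rw [one_div, Real.rpow_inv_natCast_pow hx (by omega)]
      rw [← hpow]
      exact pow_le_pow_left₀ (Real.rpow_nonneg hx _) hn.le n
    calc c ^ n * ‖K ^ n‖ ≤ c ^ n * ε ^ n := by gcongr
      _ = (c * ε) ^ n := by rw [mul_pow]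
      _ ≤ (1 / 2 : ℝ) ^ n := pow_le_pow_left₀ (mul_nonneg hc hε0.le) hcε n
  have hgeom : Tendsto (fun n : ℕ => (1 / 2 : ℝ) ^ n) atTop (𝓝 0) :=
    tendsto_pow_atTop_nhds_zero_of_lt_one (by norm_num) (by norm_num)
  exact squeeze_zero' (Eventually.of_forall fun n => by positivity) hev hgeom

/-! ### Hilden's argument: the quasinilpotent branch -/

/-- **Hilden's argument** (Radjavi–Rosenthal p. 161; Michaels 1977).  A non-zero compact operator with `σ(K) ⊆ {0}`
has a non-trivial closed hyperinvariant subspace.  Proof: if not, every non-zero vector has a dense commutant orbit;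
choose `x₀` with `‖K x₀‖ = ‖K‖ + 1` and `B = closedBall x₀ 1` (so `‖K z‖ ≥ 1` and `‖z‖ ≥ ‖x₀‖ − 1 > 0` on `B`); the
compact set `closure (K '' B)` avoids `0` and is covered by finitely many `Aᵢ⁻¹(ball x₀ 1)` with `Aᵢ` in the
commutant; with `c = Σ ‖Aᵢ‖` iterate `x_{m+1} = A K x_m ∈ B`: `x_m = P_m K^m x₀`, `‖P_m‖ ≤ c^m`, so
`‖x₀‖ − 1 ≤ ‖x_m‖ ≤ c^m ‖K^m‖ ‖x₀‖ → 0`, a contradiction. [cite: Michaels1977] -/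
theorem exists_hyperinvariant_of_isCompactOperator_of_spectrum_subset_zero [CompleteSpace H] (K : H →L[ℂ] H)
    (hK : IsCompactOperator K) (hK0 : K ≠ 0) (hσ : spectrum ℂ K ⊆ {0}) :
    ∃ M : Submodule ℂ H, IsClosed (M : Set H) ∧ M ≠ ⊥ ∧ M ≠ ⊤ ∧
      ∀ S : H →L[ℂ] H, Commute S K → IsInvariant S M := by
  by_contra hno
  push Not at hno
  have hdense : ∀ y : H, y ≠ 0 → Dense (commutantOrbit K y : Set H) :=
    fun y hy => dense_commutantOrbit_of_no_hyperinvariant hno hy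
  -- a vector on which `K` does not vanish, rescaled so that `‖K x₀‖ = ‖K‖ + 1`
  obtain ⟨x₁, hx₁⟩ : ∃ x : H, K x ≠ 0 := by
    by_contra h
    push Not at h
    exact hK0 (ContinuousLinearMap.ext fun x => by simpa using h x)
  have hKx₁ : 0 < ‖K x₁‖ := norm_pos_iff.mpr hx₁
  have hKpos : 0 < ‖K‖ := norm_pos_iff.mpr hK0
  set t : ℝ := (‖K‖ + 1) / ‖K x₁‖ with ht
  have ht0 : 0 < t := by positivity
  set x₀ : H := (t : ℂ) • x₁ with hx₀def
  have hKx₀ : ‖K x₀‖ = ‖K‖ + 1 := by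
    rw [hx₀def, map_smul, norm_smul, Complex.norm_real, Real.norm_of_nonneg ht0.le, ht,
      div_mul_cancel₀ _ hKx₁.ne']
  have hx₀gt : 1 < ‖x₀‖ := by
    by_contra hle
    push Not at hle
    have h1 : ‖K‖ + 1 ≤ ‖K‖ * ‖x₀‖ := hKx₀ ▸ K.le_opNorm x₀
    have h2 : ‖K‖ * ‖x₀‖ ≤ ‖K‖ * 1 := by gcongr
    linarith
  have hx₀pos : 0 < ‖x₀‖ := by linarith
  -- the ball `B` and the two estimates on it
  set B : Set H := Metric.closedBall x₀ 1 with hB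
  have hBnorm : ∀ z ∈ B, ‖x₀‖ - 1 ≤ ‖z‖ := by
    intro z hz
    rw [hB, Metric.mem_closedBall, dist_eq_norm] at hz
    have := norm_sub_norm_le x₀ z
    rw [← norm_neg, neg_sub] at hz
    linarith
  have hBK : ∀ z ∈ B, 1 ≤ ‖K z‖ := by
    intro z hz
    rw [hB, Metric.mem_closedBall, dist_eq_norm] at hz
    have h1 : ‖K (x₀ - z)‖ ≤ ‖K‖ * 1 := by
      refine (K.le_opNorm _).trans ?_
      gcongr
      rwa [← norm_neg, neg_sub]
    have h2 : ‖K x₀‖ - ‖K x₀ - K z‖ ≤ ‖K x₀ - (K x₀ - K z)‖ := norm_sub_norm_le _ _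
    rw [sub_sub_cancel, ← map_sub] at h2
    linarith
  -- the compact set `closure (K '' B)`; it avoids `0`
  have hScpt : IsCompact (closure (K '' B)) := by
    simpa only [ContinuousLinearMap.coe_coe] using
      hK.isCompact_closure_image_of_bounded (f := (K : H →ₗ[ℂ] H)) (Metric.isBounded_closedBall (x := x₀) (r := 1))
  have hSnorm : ∀ y ∈ closure (K '' B), 1 ≤ ‖y‖ := by
    have hcl : IsClosed {y : H | 1 ≤ ‖y‖} := isClosed_le continuous_const continuous_norm
    have hsub : K '' B ⊆ {y : H | 1 ≤ ‖y‖} := by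
      rintro _ ⟨z, hz, rfl⟩
      exact hBK z hz
    exact fun y hy => closure_minimal hsub hcl hy
  -- the open cover of `closure (K '' B)` indexed by the commutant, and a finite subcover
  let ι := {A : H →L[ℂ] H // Commute A K}
  let U : ι → Set H := fun A => (A : H →L[ℂ] H) ⁻¹' Metric.ball x₀ 1
  have hUo : ∀ i, IsOpen (U i) := fun i => Metric.isOpen_ball.preimage (i : H →L[ℂ] H).continuous
  have hcov : closure (K '' B) ⊆ ⋃ i, U i := by
    intro y hy
    have hy0 : y ≠ 0 := by
      intro h
      have := hSnorm y hy
      rw [h, norm_zero] at this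
      linarith
    obtain ⟨x, hxO, hxball⟩ :=
      (hdense y hy0).exists_mem_open Metric.isOpen_ball ⟨x₀, Metric.mem_ball_self one_pos⟩
    obtain ⟨A, hA, rfl⟩ := (mem_commutantOrbit (K := K)).mp hxO
    exact Set.mem_iUnion.mpr ⟨⟨A, hA⟩, hxball⟩
  obtain ⟨tfin, htfin⟩ := hScpt.elim_finite_subcover U hUo hcov
  -- the constant `c = Σ ‖Aᵢ‖`
  set c : ℝ := ∑ i ∈ tfin, ‖(i : H →L[ℂ] H)‖ with hc
  have hc0 : 0 ≤ c := Finset.sum_nonneg fun i _ => norm_nonneg _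
  have hci : ∀ i ∈ tfin, ‖(i : H →L[ℂ] H)‖ ≤ c := fun i hi =>
    Finset.single_le_sum (f := fun j : ι => ‖(j : H →L[ℂ] H)‖) (fun j _ => norm_nonneg _) hi
  -- one step of the iteration: from `z ∈ B` to `A (K z) ∈ B` with `A` in the commutant, `‖A‖ ≤ c`
  have hstep : ∀ z ∈ B, ∃ A : H →L[ℂ] H, Commute A K ∧ ‖A‖ ≤ c ∧ A (K z) ∈ B := by
    intro z hz
    have hKz : K z ∈ closure (K '' B) := subset_closure ⟨z, hz, rfl⟩
    obtain ⟨i, hi, hiz⟩ := Set.mem_iUnion₂.mp (htfin hKz)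
    exact ⟨i, i.2, hci i hi, Metric.ball_subset_closedBall hiz⟩
  choose! next hnc hnn hnB using hstep
  -- the iteration `x_{m+1} = A_m K x_m`
  obtain ⟨z, hz0, hzs⟩ : ∃ z : ℕ → H, z 0 = x₀ ∧ ∀ m, z (m + 1) = next (z m) (K (z m)) :=
    ⟨fun m => Nat.rec x₀ (fun _ w => next w (K w)) m, rfl, fun _ => rfl⟩
  have hinv : ∀ m : ℕ, z m ∈ B ∧
      ∃ P : H →L[ℂ] H, Commute P K ∧ ‖P‖ ≤ c ^ m ∧ z m = P ((K ^ m) x₀) := by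
    intro m
    induction m with
    | zero =>
      refine ⟨hz0 ▸ Metric.mem_closedBall_self zero_le_one, 1, Commute.one_left K, ?_, by simp [hz0]⟩
      rw [pow_zero, ContinuousLinearMap.one_def]
      exact ContinuousLinearMap.norm_id_le
    | succ m ih =>
      obtain ⟨hmB, P, hP, hPn, hzm⟩ := ih
      have hA := hnc (z m) hmB
      have hAn := hnn (z m) hmB
      have hAB := hnB (z m) hmB
      refine ⟨by rw [hzs]; exact hAB, next (z m) * P, hA.mul_left hP, ?_, ?_⟩
      · calc ‖next (z m) * P‖ ≤ ‖next (z m)‖ * ‖P‖ := norm_mul_le _ _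
          _ ≤ c * c ^ m := by gcongr
          _ = c ^ (m + 1) := by ring
      · have hmul : ∀ (A R : H →L[ℂ] H) (v : H), (A * R) v = A (R v) := fun _ _ _ => rfl
        have hKP : K (P ((K ^ m) x₀)) = P (K ((K ^ m) x₀)) := by
          have e := congrArg (fun R : H →L[ℂ] H => R ((K ^ m) x₀)) hP.eq
          simpa only [hmul] using e.symm
        rw [hzs m, hmul, pow_succ', hmul, ← hKP, ← hzm]
  -- the contradiction: `‖x₀‖ - 1 ≤ ‖z m‖ ≤ c ^ m * ‖K ^ m‖ * ‖x₀‖ → 0`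
  have hlim := tendsto_pow_mul_norm_pow_of_spectrum_subset_zero K hσ hc0
  have hsmall : ∀ᶠ m : ℕ in atTop, c ^ m * ‖K ^ m‖ < (‖x₀‖ - 1) / ‖x₀‖ :=
    (tendsto_order.1 hlim).2 _ (div_pos (by linarith) hx₀pos)
  obtain ⟨m, hm⟩ := hsmall.exists
  obtain ⟨hmB, P, hP, hPn, hzm⟩ := hinv m
  have h1 : ‖x₀‖ - 1 ≤ ‖z m‖ := hBnorm _ hmB
  have h2 : ‖z m‖ ≤ c ^ m * ‖K ^ m‖ * ‖x₀‖ := by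
    rw [hzm]
    calc ‖P ((K ^ m) x₀)‖ ≤ ‖P‖ * ‖(K ^ m) x₀‖ := P.le_opNorm _
      _ ≤ ‖P‖ * (‖K ^ m‖ * ‖x₀‖) := by
          gcongr
          exact (K ^ m).le_opNorm x₀
      _ ≤ c ^ m * (‖K ^ m‖ * ‖x₀‖) := by gcongr
      _ = c ^ m * ‖K ^ m‖ * ‖x₀‖ := by ring
  have h3 : c ^ m * ‖K ^ m‖ * ‖x₀‖ < ‖x₀‖ - 1 := by
    have := mul_lt_mul_of_pos_right hm hx₀pos
    rwa [div_mul_cancel₀ _ hx₀pos.ne'] at this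
  linarith

/-! ### The eigenvalue branch, and Lomonosov's theorem -/

/-- An EIGENVALUE `μ` of a non-scalar operator `K` gives the non-trivial closed hyperinvariant subspace `ker (K − μ)`
(`≠ ⊥`: an eigenvector; `≠ ⊤`: `K ≠ μ`; invariant under every `S` commuting with `K`: `isInvariant_ker_of_commute`).
[folklore] -/
theorem exists_hyperinvariant_of_hasEigenvalue (K : H →L[ℂ] H) {μ : ℂ}
    (hμ : Module.End.HasEigenvalue (K : Module.End ℂ H) μ) (hKμ : K ≠ μ • (1 : H →L[ℂ] H)) :
    ∃ M : Submodule ℂ H, IsClosed (M : Set H) ∧ M ≠ ⊥ ∧ M ≠ ⊤ ∧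
      ∀ S : H →L[ℂ] H, Commute S K → IsInvariant S M := by
  set G : H →L[ℂ] H := K - μ • 1 with hG
  refine ⟨LinearMap.ker (G : H →ₗ[ℂ] H), G.isClosed_ker, ?_, ?_,
    fun S hS => isInvariant_ker_of_commute S G (hS.sub_right ((Commute.one_right S).smul_right μ))⟩
  · obtain ⟨v, hv⟩ := hμ.exists_hasEigenvector
    intro hbot
    have hKv : K v = μ • v := by simpa using hv.apply_eq_smul
    have hGv : G v = 0 := by simp [hG, hKv]
    have hvker : v ∈ LinearMap.ker (G : H →ₗ[ℂ] H) := by simpa using hGv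
    rw [hbot, Submodule.mem_bot] at hvker
    exact hv.2 hvker
  · intro htop
    apply hKμ
    have hG0 : G = 0 := by
      ext x
      have hx : x ∈ LinearMap.ker (G : H →ₗ[ℂ] H) := htop ▸ Submodule.mem_top
      simpa using hx
    rw [hG] at hG0
    exact sub_eq_zero.mp hG0

/-- A compact operator on an INFINITE-dimensional space is not a non-zero scalar (else the identity `μ⁻¹ K` would be
compact: Riesz). [folklore] -/
lemma ne_smul_one_of_isCompactOperator {K : H →L[ℂ] H} (hK : IsCompactOperator K)
    (hH : ¬ FiniteDimensional ℂ H) {μ : ℂ} (hμ : μ ≠ 0) : K ≠ μ • (1 : H →L[ℂ] H) := by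
  intro hKμ
  apply hH
  have h1 : IsCompactOperator (μ⁻¹ • (K : H → H)) := hK.smul μ⁻¹
  have h2 : (μ⁻¹ • (K : H → H)) = id := by
    funext x
    simp [hKμ, smul_smul, inv_mul_cancel₀ hμ]
  rw [h2] at h1
  exact FiniteDimensional.of_isCompactOperator_id (𝕜 := ℂ) (E := H) h1

/-- **Lomonosov's hyperinvariant-subspace theorem for compact operators** (Radjavi–Rosenthal Cor. 8.25, via Hilden's
proof): every non-zero compact operator `K` on an infinite-dimensional complex Hilbert space has a non-trivial closed
subspace invariant under EVERY operator commuting with `K`.  Branches: `σ(K) ⊆ {0}` (Hilden's argument,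
`exists_hyperinvariant_of_isCompactOperator_of_spectrum_subset_zero`) or some `0 ≠ μ ∈ σ(K)`, an eigenvalue by the
Fredholm alternative (`exists_hyperinvariant_of_hasEigenvalue`). [cite: RadjaviRosenthal1973, Cor. 8.25] -/
theorem exists_hyperinvariant_of_isCompactOperator [CompleteSpace H] (K : H →L[ℂ] H) (hK : IsCompactOperator K)
    (hK0 : K ≠ 0) (hH : ¬ FiniteDimensional ℂ H) :
    ∃ M : Submodule ℂ H, IsClosed (M : Set H) ∧ M ≠ ⊥ ∧ M ≠ ⊤ ∧
      ∀ S : H →L[ℂ] H, Commute S K → IsInvariant S M := by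
  by_cases hσ : spectrum ℂ K ⊆ {0}
  · exact exists_hyperinvariant_of_isCompactOperator_of_spectrum_subset_zero K hK hK0 hσ
  · obtain ⟨μ, hμσ, hμ0⟩ := Set.not_subset.mp hσ
    rw [Set.mem_singleton_iff] at hμ0
    have hev : Module.End.HasEigenvalue (K : Module.End ℂ H) μ :=
      (IsCompactOperator.hasEigenvalue_iff_mem_spectrum hK hμ0).mpr hμσ
    exact exists_hyperinvariant_of_hasEigenvalue K hev (ne_smul_one_of_isCompactOperator hK hH hμ0)

/-- **REPAIR CENSUS R8, second clause, closed in Lean (Lomonosov 1973): an operator `T` COMMUTING WITH A NON-ZERO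
COMPACT OPERATOR `K` on a complex Hilbert space of dimension `≥ 2` has a non-trivial closed invariant subspace** — a
hyperinvariant subspace of `K` in infinite dimension, an eigenline in finite dimension (`Reductions.lean`).  No
Main-Construction data, no room claim: the manuscript's mechanism plays no role. [cite: Lomonosov1973] -/
theorem hasNontrivialClosedInvariantSubspace_of_commute_isCompactOperator [CompleteSpace H] (T K : H →L[ℂ] H)
    (hK : IsCompactOperator K) (hK0 : K ≠ 0) (hTK : Commute T K) (hH : 1 < Module.rank ℂ H) :
    HasNontrivialClosedInvariantSubspace T := by
  by_cases hfin : FiniteDimensional ℂ H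
  · have h1 : 1 < Module.finrank ℂ H := by
      rw [← Module.finrank_eq_rank] at hH
      exact_mod_cast hH
    exact hasNontrivialClosedInvariantSubspace_of_finiteDimensional (by omega) T
  · obtain ⟨M, hMc, hMb, hMt, hMi⟩ := exists_hyperinvariant_of_isCompactOperator K hK hK0 hfin
    exact ⟨M, hMc, hMb, hMt, hMi T hTK⟩

/-- **REPAIR CENSUS R8, first clause, unconditionally: a COMPACT operator on a complex Hilbert space of dimension
`≥ 2` has a non-trivial closed invariant subspace** (von Neumann / Aronszajn–Smith; here as `T = K` in Lomonosov's
theorem, the zero operator being a scalar with an eigenline).  `CompactCase.lean` derived this row from the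
Main-Construction data; none is needed. [cite: RadjaviRosenthal1973, Cor. 8.25] -/
theorem hasNontrivialClosedInvariantSubspace_of_isCompactOperator [CompleteSpace H] (K : H →L[ℂ] H)
    (hK : IsCompactOperator K) (hH : 1 < Module.rank ℂ H) : HasNontrivialClosedInvariantSubspace K := by
  by_cases hK0 : K = 0
  · have : Nontrivial H := rank_pos_iff_nontrivial.mp (lt_trans zero_lt_one hH)
    obtain ⟨v, hv⟩ := exists_ne (0 : H)
    exact hasNontrivialClosedInvariantSubspace_of_eigenvector K (μ := 0) hv (by simp [hK0])
      (span_singleton_ne_top_of_one_lt_rank hH v)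
  · exact hasNontrivialClosedInvariantSubspace_of_commute_isCompactOperator K K hK hK0 (Commute.refl K) hH

/-- **REPAIR CENSUS R8 (second clause) in the shape of R8/R9/R12**: `T` commuting with a non-zero compact `K` and ANY
sequence of Main-Construction outputs as on v2 p.4 (`‖x₀‖ = 1`, `0.3 ≤ ‖x₀ − w_n‖ ≤ 0.7`, (9)
`|⟨x₀ − w_n, T^j w_n⟩| ≤ ε_n → 0`) give a non-trivial closed invariant subspace — the data are used ONLY to exclude
`dim H ≤ 1` (`one_lt_rank_of_MC`); no weak or norm limit, no room claim, no injectivity.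
[cite: Enflo2023, v2 p.4 (11) and p.20] -/
theorem hasNontrivialClosedInvariantSubspace_of_commute_isCompactOperator_MC [CompleteSpace H] (T K : H →L[ℂ] H)
    (hK : IsCompactOperator K) (hK0 : K ≠ 0) (hTK : Commute T K)
    (x₀ : H) (hx₀ : ‖x₀‖ = 1) (w : ℕ → H) (ε : ℕ → ℝ)
    (hdist : ∀ n, 0.3 ≤ ‖x₀ - w n‖ ∧ ‖x₀ - w n‖ ≤ 0.7) (hε : Tendsto ε atTop (𝓝 0))
    (h : ∀ n j, ‖⟪x₀ - w n, (T ^ j) (w n)⟫_ℂ‖ ≤ ε n) : HasNontrivialClosedInvariantSubspace T :=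
  hasNontrivialClosedInvariantSubspace_of_commute_isCompactOperator T K hK hK0 hTK
    (one_lt_rank_of_MC x₀ hx₀ w ε hdist hε fun n => by simpa using h n 0)

end Literature.Analysis.OperatorTheory.Enflo2023
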